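import Mathlib
import HarnessLib

/-!
# Cesàro upgrade, helper 2: unbounded continuous integrands under weak convergence

Support file for item `stmt-AtomisticToContinuum-13981` (`ParityLiouvilleSeed.CesaroUpgrade`).

Pure measure theory on a topological space `Ω` (Borel sets measurable), for a net of probability
measures `μs i → μ` in the topology of weak convergence (`MeasureTheory.ProbabilityMeasure`)
along an arbitrary non-trivial filter:

* `integrable_of_tendsto_of_integral_le` — FATOU for weak limits: a non-negative continuous `g`
  with `∫ g d(μs i) ≤ A` for all `i` is `μ`-integrable with `∫ g dμ ≤ A` (truncate at height `M`,
  pass to the weak limit, monotone convergence);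
* `tendsto_integral_of_tendsto_of_sq_le` — UNIFORM INTEGRABILITY from a second moment: a
  continuous `g` with `∫ g² d(μs i) ≤ A` for all `i` has `∫ g d(μs i) → ∫ g dμ` (clamp `g` to
  `[-L, L]`; the error is at most `A / L` uniformly, `|t - clamp_L t| ≤ t² / L`).

No definitions; the clamp is written `max (-L) (min (g ω) L)` (the elementary clamp estimates are
inlined; the same truncation device appears in `PhononMeanFreePathBoundaryKuboKernelContinuity`).
-/

noncomputable section

namespace Summit.AtomisticToContinuum.FouriersLaw.Theorems.CesaroUpgrade

open MeasureTheory Filter Topology Set BoundedContinuousFunction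
open scoped ENNReal

variable {Ω : Type*} [MeasurableSpace Ω] [TopologicalSpace Ω] [OpensMeasurableSpace Ω]

/-! ### Clamps -/

/-- The clamp is bounded by `L`. [folklore] -/
theorem abs_clamp_le {L : ℝ} (hL : 0 ≤ L) (t : ℝ) : |max (-L) (min t L)| ≤ L := by
  rw [abs_le]
  exact ⟨le_max_left _ _, max_le (by linarith) (min_le_right _ _)⟩

omit [MeasurableSpace Ω] [OpensMeasurableSpace Ω] in
/-- The clamp of a continuous function, as a bounded continuous function. [folklore] -/
theorem exists_boundedContinuous_clamp {g : Ω → ℝ} (hg : Continuous g) {L : ℝ} (hL : 0 ≤ L) :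
    ∃ φ : Ω →ᵇ ℝ, ∀ ω, φ ω = max (-L) (min (g ω) L) := by
  refine ⟨BoundedContinuousFunction.ofNormedAddCommGroup (fun ω => max (-L) (min (g ω) L))
    (by fun_prop) L fun ω => ?_, fun ω => rfl⟩
  rw [Real.norm_eq_abs]
  exact abs_clamp_le hL _

omit [MeasurableSpace Ω] [OpensMeasurableSpace Ω] in
/-- The truncation of a non-negative continuous function at height `M`, as a bounded continuous
function. [folklore] -/
theorem exists_boundedContinuous_min {g : Ω → ℝ} (hg : Continuous g) (hg0 : ∀ ω, 0 ≤ g ω)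
    {M : ℝ} (hM : 0 ≤ M) : ∃ φ : Ω →ᵇ ℝ, ∀ ω, φ ω = min (g ω) M := by
  refine ⟨BoundedContinuousFunction.ofNormedAddCommGroup (fun ω => min (g ω) M)
    (by fun_prop) M fun ω => ?_, fun ω => rfl⟩
  rw [Real.norm_eq_abs, abs_of_nonneg (le_min (hg0 ω) hM)]
  exact min_le_right _ _

/-! ### Fatou for weak limits -/

variable {ι : Type*} {F : Filter ι} {μs : ι → ProbabilityMeasure Ω} {μ : ProbabilityMeasure Ω}

/-- **Fatou for weak limits.** If `μs i → μ` weakly, `g ≥ 0` is continuous and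
`∫ g d(μs i) ≤ A` (with `g ∈ L¹(μs i)`) for all `i`, then `g ∈ L¹(μ)` and `∫ g dμ ≤ A`.
[folklore] -/
theorem integrable_of_tendsto_of_integral_le [NeBot F] (hlim : Tendsto μs F (𝓝 μ))
    {g : Ω → ℝ} (hg : Continuous g) (hg0 : ∀ ω, 0 ≤ g ω) {A : ℝ}
    (hA : ∀ i, Integrable g (μs i) ∧ ∫ ω, g ω ∂(μs i : Measure Ω) ≤ A) :
    Integrable g (μ : Measure Ω) ∧ ∫ ω, g ω ∂(μ : Measure Ω) ≤ A := by
  have hA0 : 0 ≤ A := by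
    obtain ⟨i⟩ := F.nonempty_of_neBot
    exact (integral_nonneg fun ω => hg0 ω).trans (hA i).2
  -- truncations pass to the limit
  have htrunc : ∀ M : ℕ, Integrable (fun ω => min (g ω) M) (μ : Measure Ω) ∧
      ∫ ω, min (g ω) M ∂(μ : Measure Ω) ≤ A := by
    intro M
    obtain ⟨φ, hφ⟩ := exists_boundedContinuous_min hg hg0 (Nat.cast_nonneg M)
    have hφint : ∀ ρ : Measure Ω, IsFiniteMeasure ρ → Integrable (fun ω => min (g ω) (M : ℝ)) ρ :=
      fun ρ _ => (φ.integrable ρ).congr (Eventually.of_forall hφ)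
    refine ⟨hφint μ inferInstance, ?_⟩
    have hconv : Tendsto (fun i => ∫ ω, φ ω ∂(μs i : Measure Ω)) F (𝓝 (∫ ω, φ ω ∂(μ : Measure Ω))) :=
      (ProbabilityMeasure.tendsto_iff_forall_integral_tendsto.mp hlim) φ
    have hle : ∀ i, ∫ ω, φ ω ∂(μs i : Measure Ω) ≤ A := fun i => by
      calc ∫ ω, φ ω ∂(μs i : Measure Ω) = ∫ ω, min (g ω) (M : ℝ) ∂(μs i : Measure Ω) :=
            integral_congr_ae (Eventually.of_forall hφ)
        _ ≤ ∫ ω, g ω ∂(μs i : Measure Ω) :=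
            integral_mono (hφint _ inferInstance) (hA i).1 fun ω => min_le_left _ _
        _ ≤ A := (hA i).2
    have := le_of_tendsto' hconv hle
    rwa [integral_congr_ae (Eventually.of_forall hφ)] at this
  -- monotone convergence in `ℝ≥0∞`
  have hmeas : AEStronglyMeasurable g (μ : Measure Ω) := hg.aestronglyMeasurable
  have hlin : Tendsto (fun M : ℕ => ∫⁻ ω, ENNReal.ofReal (min (g ω) M) ∂(μ : Measure Ω)) atTop
      (𝓝 (∫⁻ ω, ENNReal.ofReal (g ω) ∂(μ : Measure Ω))) := by
    refine lintegral_tendsto_of_tendsto_of_monotone (fun M => ?_) ?_ ?_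
    · exact (ENNReal.measurable_ofReal.comp (hg.min continuous_const).measurable).aemeasurable
    · refine Eventually.of_forall fun ω => fun M M' hMM' => ?_
      exact ENNReal.ofReal_le_ofReal (min_le_min_left _ (by exact_mod_cast hMM'))
    · refine Eventually.of_forall fun ω => ?_
      refine tendsto_const_nhds.congr' ?_
      filter_upwards [eventually_ge_atTop ⌈g ω⌉₊] with M hM
      rw [min_eq_left (le_trans (Nat.le_ceil _) (by exact_mod_cast hM))]
  have hbound : ∀ M : ℕ, ∫⁻ ω, ENNReal.ofReal (min (g ω) M) ∂(μ : Measure Ω) ≤ ENNReal.ofReal A := by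
    intro M
    rw [← ofReal_integral_eq_lintegral_ofReal (htrunc M).1
      (Eventually.of_forall fun ω => le_min (hg0 ω) (Nat.cast_nonneg M))]
    exact ENNReal.ofReal_le_ofReal (htrunc M).2
  have hle : ∫⁻ ω, ENNReal.ofReal (g ω) ∂(μ : Measure Ω) ≤ ENNReal.ofReal A :=
    le_of_tendsto' hlin hbound
  have henorm : ∫⁻ ω, ‖g ω‖ₑ ∂(μ : Measure Ω) = ∫⁻ ω, ENNReal.ofReal (g ω) ∂(μ : Measure Ω) :=
    lintegral_congr fun ω => Real.enorm_eq_ofReal (hg0 ω)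
  have hint : Integrable g (μ : Measure Ω) :=
    ⟨hmeas, by rw [HasFiniteIntegral, henorm]; exact lt_of_le_of_lt hle ENNReal.ofReal_lt_top⟩
  refine ⟨hint, ?_⟩
  rw [integral_eq_lintegral_of_nonneg_ae (Eventually.of_forall hg0) hmeas]
  calc (∫⁻ ω, ENNReal.ofReal (g ω) ∂(μ : Measure Ω)).toReal ≤ (ENNReal.ofReal A).toReal :=
        ENNReal.toReal_mono ENNReal.ofReal_ne_top hle
    _ = A := ENNReal.toReal_ofReal hA0

/-! ### Uniform integrability from a second moment -/

omit [TopologicalSpace Ω] [OpensMeasurableSpace Ω] in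
/-- The clamp error in `L¹`: `|∫ g dρ - ∫ clamp_L g dρ| ≤ A / L` when `∫ g² dρ ≤ A`. [folklore] -/
theorem abs_integral_sub_integral_clamp_le {ρ : Measure Ω} [IsFiniteMeasure ρ] {g : Ω → ℝ}
    (hgm : AEStronglyMeasurable g ρ) (hg2 : Integrable (fun ω => g ω ^ 2) ρ) {A L : ℝ}
    (hA : ∫ ω, g ω ^ 2 ∂ρ ≤ A) (hL : 0 < L) :
    Integrable g ρ ∧ Integrable (fun ω => max (-L) (min (g ω) L)) ρ ∧
      |∫ ω, g ω ∂ρ - ∫ ω, max (-L) (min (g ω) L) ∂ρ| ≤ A / L := by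
  -- `|t| ≤ 1 + t²` and `|t - clamp_L t| ≤ t² / L`
  have hsq : ∀ t : ℝ, |t| ≤ 1 + t ^ 2 := fun t => by
    rcases le_total 0 t with h | h
    · rw [abs_of_nonneg h]; nlinarith
    · rw [abs_of_nonpos h]; nlinarith
  have hclamp : ∀ t : ℝ, |t - max (-L) (min t L)| ≤ t ^ 2 / L := fun t => by
    rw [le_div_iff₀ hL]
    rcases le_total t L with h1 | h1
    · rw [min_eq_left h1]
      rcases le_total (-L) t with h2 | h2
      · rw [max_eq_right h2, sub_self, abs_zero, zero_mul]; positivity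
      · rw [max_eq_left h2]
        have : |t - -L| = -L - t := by
          rw [abs_of_nonpos (by linarith)]; ring
        rw [this]
        nlinarith
    · rw [min_eq_right h1, max_eq_right (by linarith : -L ≤ L), abs_of_nonneg (by linarith)]
      nlinarith
  have hgint : Integrable g ρ :=
    ((integrable_const (1 : ℝ)).add hg2).mono' hgm (Eventually.of_forall fun ω => by
      rw [Real.norm_eq_abs]; exact hsq _)
  have hcl : Integrable (fun ω => max (-L) (min (g ω) L)) ρ := by
    refine (integrable_const L).mono' ?_ (Eventually.of_forall fun ω => by
      rw [Real.norm_eq_abs]; exact abs_clamp_le hL.le _)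
    exact (aemeasurable_const.max (hgm.aemeasurable.min aemeasurable_const)).aestronglyMeasurable
  refine ⟨hgint, hcl, ?_⟩
  rw [← integral_sub hgint hcl]
  calc |∫ ω, (g ω - max (-L) (min (g ω) L)) ∂ρ| ≤ ∫ ω, |g ω - max (-L) (min (g ω) L)| ∂ρ :=
        abs_integral_le_integral_abs
    _ ≤ ∫ ω, g ω ^ 2 / L ∂ρ :=
        integral_mono (hgint.sub hcl).abs (hg2.div_const L) fun ω => hclamp _
    _ = (∫ ω, g ω ^ 2 ∂ρ) / L := integral_div _ _
    _ ≤ A / L := by gcongr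

/-- **Weak convergence with a uniform second moment.** If `μs i → μ` weakly, `g` is continuous and
`∫ g² d(μs i) ≤ A` for all `i`, then `g ∈ L¹(μ)`, `∫ g² dμ ≤ A`, and `∫ g d(μs i) → ∫ g dμ`.
[folklore] -/
theorem tendsto_integral_of_tendsto_of_sq_le [NeBot F] (hlim : Tendsto μs F (𝓝 μ))
    {g : Ω → ℝ} (hg : Continuous g) {A : ℝ}
    (hA : ∀ i, Integrable (fun ω => g ω ^ 2) (μs i) ∧ ∫ ω, g ω ^ 2 ∂(μs i : Measure Ω) ≤ A) :
    Integrable g (μ : Measure Ω) ∧ Integrable (fun ω => g ω ^ 2) (μ : Measure Ω) ∧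
      ∫ ω, g ω ^ 2 ∂(μ : Measure Ω) ≤ A ∧
      Tendsto (fun i => ∫ ω, g ω ∂(μs i : Measure Ω)) F (𝓝 (∫ ω, g ω ∂(μ : Measure Ω))) := by
  obtain ⟨hg2, hg2le⟩ := integrable_of_tendsto_of_integral_le (g := fun ω => g ω ^ 2) hlim
    (hg.pow 2) (fun ω => sq_nonneg _) hA
  have hA0 : 0 ≤ A := (integral_nonneg fun ω => sq_nonneg (g ω)).trans hg2le
  have hμ := fun {L : ℝ} (hL : 0 < L) =>
    abs_integral_sub_integral_clamp_le (ρ := (μ : Measure Ω)) hg.aestronglyMeasurable hg2 hg2le hL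
  have hμs := fun (i : ι) {L : ℝ} (hL : 0 < L) =>
    abs_integral_sub_integral_clamp_le (ρ := (μs i : Measure Ω)) hg.aestronglyMeasurable (hA i).1
      (hA i).2 hL
  refine ⟨(hμ one_pos).1, hg2, hg2le, ?_⟩
  rw [Metric.tendsto_nhds]
  intro ε hε
  -- choose the clamp level
  set L : ℝ := 3 * A / ε + 1 with hLdef
  have hL : 0 < L := by
    have : 0 ≤ 3 * A / ε := div_nonneg (by linarith) hε.le
    linarith
  have hAL : A / L < ε / 3 := by
    rw [div_lt_iff₀ hL]
    have : ε / 3 * L = A + ε / 3 := by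
      rw [hLdef]; field_simp
    rw [this]; linarith
  obtain ⟨φ, hφ⟩ := exists_boundedContinuous_clamp hg hL.le
  have hconv : Tendsto (fun i => ∫ ω, φ ω ∂(μs i : Measure Ω)) F (𝓝 (∫ ω, φ ω ∂(μ : Measure Ω))) :=
    (ProbabilityMeasure.tendsto_iff_forall_integral_tendsto.mp hlim) φ
  have hφeq : ∀ ρ : Measure Ω, ∫ ω, φ ω ∂ρ = ∫ ω, max (-L) (min (g ω) L) ∂ρ :=
    fun ρ => integral_congr_ae (Eventually.of_forall hφ)
  filter_upwards [Metric.tendsto_nhds.mp hconv (ε / 3) (by positivity)] with i hi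
  rw [Real.dist_eq] at hi ⊢
  rw [hφeq, hφeq] at hi
  have h1 := (hμs i hL).2.2
  have h2 := (hμ hL).2.2
  set a := ∫ ω, g ω ∂(μs i : Measure Ω) with ha
  set b := ∫ ω, max (-L) (min (g ω) L) ∂(μs i : Measure Ω) with hb
  set c := ∫ ω, g ω ∂(μ : Measure Ω) with hc
  set d := ∫ ω, max (-L) (min (g ω) L) ∂(μ : Measure Ω) with hd
  have h3 : |a - c| ≤ |a - b| + |b - d| + |c - d| := by
    have e1 : a - c = (a - b) + (b - d) - (c - d) := by ring
    rw [e1]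
    exact (abs_sub _ _).trans (by linarith [abs_add_le (a - b) (b - d)])
  calc |a - c| ≤ |a - b| + |b - d| + |c - d| := h3
    _ < ε / 3 + ε / 3 + ε / 3 := by
        gcongr
        · exact lt_of_le_of_lt h1 hAL
        · exact lt_of_le_of_lt h2 hAL
    _ = ε := by ring

end Summit.AtomisticToContinuum.FouriersLaw.Theorems.CesaroUpgrade

end
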